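import Literature.MathematicalPhysics.KineticTheory.CollisionFluxUpperBound
import Literature.MathematicalPhysics.KineticTheory.HardSphereCanonicalPairBound
import Literature.MathematicalPhysics.KineticTheory.CollisionTubeWeightOscillation
import Literature.Analysis.FluidPDE.HardSphereCollisionRecord
import Literature.Analysis.FluidPDE.LinearizedHsNSF
import Summits.AtomisticToContinuum.HydrodynamicLimit.Theorems.JParityClosureCollisionTightnessSweptTube
import Summits.AtomisticToContinuum.HydrodynamicLimit.Theorems.JParityClosureCollisionTightnessTorusGibbs
import Summits.AtomisticToContinuum.HydrodynamicLimit.Theorems.JParityClosureOddContactSymmetryGibbsInvariance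
import HarnessLib

/-!
# Crux `InformationPercolationEngine.CollisionRate` (stmt-AtomisticToContinuum-13481), line `Sketch`
# (card `hazard-fairness-compensator`): helper stub `stub_windowCountIntegrableInvariant` (H2)

THE WINDOWED COLLISION COUNT IS INTEGRABLE UNDER THE INVARIANT CANONICAL LAW, WITH THE COLLISION-FLUX
BOUND.  For `0 < σ < σ₀` (the small-density threshold of `exists_smallDensity uniformProfile`), every
`N ≥ 1`, every hard-sphere flow `Φ` of `N + 1` spheres of diameter `ε = hsDiameter σ N` on `𝕋³`, every
sphere `i` and every window `[s, t)`, `s ≤ t`: if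
`D(z) = #{collision times of i in [s, t) along the orbit of z}` (on the good set; `0` off it) is a
measurable function of `z`, then it is integrable under the INVARIANT canonical law
`G = localGibbsLaw σ 1 0 1 N Φ` and `E_G[D] ≤ Cf σ² (N+1)^{1/3} (t − s)` for a universal `Cf` — the
Boltzmann–Enskog collision flux onto ONE tagged sphere, uniformly in `N` (`(N+1) ε² = σ² (N+1)^{1/3}`,
`Literature.Analysis.FluidPDE.succ_mul_hsDiameter_sq`).  Proof (Cercignani–Illner–Pulvirenti 1994
App. 4.A; Gallagher–Saint-Raymond–Texier 2013 Prop. 4.1.1):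
* `lintegral_le_liminf_of_le_collisionSum` — the Fatou / time-grid / stationarity argument of
  `Literature.MathematicalPhysics.KineticTheory.measure_collisionSum_ge_le_liminf` run for the LOWER
  INTEGRAL instead of the tail (general geometry; the dominated functional may be read along the orbit
  of the SHIFTED datum `Φ_s z`, stationarity once more; no measurability of it is used);
* `natCast_ncard_collisionTimesOf_le` — PATHWISE COUNTING with the index mark `F(p, q) = 1{p = i ∨ q = i}`:
  on a good orbit `#(collision times of i in [s, t))` is at most the collision sum of `F` along the orbit
  of `Φ_s z` over `[0, t − s]`;
* `lintegral_windowCount_le` — the one-window statics `exists_windowEvent` (fed, exactly as in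
  `Theorems.EvenStressEnskog.stub_velocityTailCollisionSumRung0`, with `exists_sweptTube`,
  `volume_setOf_exists_reprSym_add_latticeVec_mem_le`, `posGibbs_pairEvent_le`, `N ≥ 1`) bounds each
  nonzero window term by `16 ε² (τ/M) I₁`, `I₁ = ∫ ‖w − v‖ dN(0,1)^{⊗2}`, and there are `2(N+1)` of them:
  `∫⁻ D dG ≤ 32 (N+1) ε² (t − s) I₁` (stationarity of `G`: `measurePreserving_flow_localGibbsLaw_const`);
* `stub_windowCountIntegrableInvariant` — integrability from the measurability hypothesis and the finite
  lower integral (`KineticTheory.lintegral_norm_sub_gauss_ne_top`), `∫ D = toReal ∫⁻ D`, `Cf := 32 I₁ + 1`.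
-/

noncomputable section

open MeasureTheory Set Filter Topology
open scoped ENNReal InnerProductSpace BigOperators Classical

namespace Summit.AtomisticToContinuum.HydrodynamicLimit.Theorems.CollisionRate

open Literature.Analysis.FluidPDE Literature.MathematicalPhysics.KineticTheory
open Literature.Analysis.FunctionSpaces

/-- **The window bound for the lower integral of a collision-dominated functional under a
flow-invariant law.** Let `Φ` be a hard-sphere flow, `P` a law preserved by every `Φ_t`, `τ > 0`,
`F(w, i, j) ∈ ℝ≥0∞` an arbitrary mark, and for every mesh `τ/M` measurable one-window events `E M i j`
(containing every non-overlapping `w` whose pair `(i, j)` reaches contact under a backward free flight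
of duration `t ∈ [0, τ/M]`) with measurable majorants `F̃ M` of the mark along those flights — the data
of `measure_collisionSum_ge_le_liminf`.  If `f ≥ 0` vanishes off the good set and, at every good `z`,
is at most the collision sum of `F` over `[0, τ]` along the orbit of the SHIFTED datum `Φ_s z`, then
`∫⁻ f dP ≤ liminf_M M · ∫ Σ_{i≠j} 𝟙_{E M i j} F̃ M (·, i, j) dP` (CIP 1994 App. 4.A). [folklore] -/
theorem lintegral_le_liminf_of_le_collisionSum {d X : Type*} [Fintype d] [MeasureSpace X]
    [TopologicalSpace X] {G : Geometry d X} {ε : ℝ} {n : ℕ} (Φ : HardSphereFlow G ε n)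
    (P : Measure (Config n d X)) (hstat : ∀ t : ℝ, MeasurePreserving (Φ.flow t) P P) {τ : ℝ}
    (hτ : 0 < τ) (F : Config n d X → Fin n → Fin n → ℝ≥0∞)
    (E : ℕ → Fin n → Fin n → Set (Config n d X)) (hEm : ∀ M i j, MeasurableSet (E M i j))
    (hE : ∀ (M : ℕ) (i j : Fin n), i ≠ j → ∀ w ∈ hardSphereDomain G n ε, ∀ t ∈ Icc 0 (τ / M),
      ‖G.sepVec ((freeFlight G (-t) w i).1) ((freeFlight G (-t) w j).1)‖ = ε → w ∈ E M i j)
    (Ft : ℕ → Config n d X → Fin n → Fin n → ℝ≥0∞) (hFtm : ∀ M i j, Measurable fun w => Ft M w i j)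
    (hFt : ∀ (M : ℕ) (i j : Fin n), i ≠ j → ∀ w ∈ hardSphereDomain G n ε, ∀ t ∈ Icc 0 (τ / M),
      ‖G.sepVec ((freeFlight G (-t) w i).1) ((freeFlight G (-t) w j).1)‖ = ε →
        F (freeFlight G (-t) w) i j ≤ Ft M w i j)
    (s : ℝ) (f : Config n d X → ℝ≥0∞)
    (hf : ∀ z ∈ Φ.good, f z ≤
      ∑ᶠ u ∈ collisionTimes G ε (fun t => Φ.flow t (Φ.flow s z)) ∩ Icc 0 τ,
        ∑ i, ∑ j, (if i ≠ j ∧ ‖G.sepVec (Φ.flow u (Φ.flow s z) i).1 (Φ.flow u (Φ.flow s z) j).1‖ = ε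
          then F (Φ.flow u (Φ.flow s z)) i j else 0))
    (hf0 : ∀ z, z ∉ Φ.good → f z = 0) :
    ∫⁻ z, f z ∂P ≤ liminf (fun M : ℕ => (M : ℝ≥0∞) *
      ∫⁻ w, ∑ i, ∑ j, (if i ≠ j then (E M i j).indicator (fun w => Ft M w i j) w else 0) ∂P) atTop := by
  classical
  -- adapted from `Literature.MathematicalPhysics.KineticTheory.measure_collisionSum_ge_le_liminf`
  set W : ℕ → Config n d X → ℝ≥0∞ := fun M w => ∑ i, ∑ j,
    (if i ≠ j then (E M i j).indicator (fun w => Ft M w i j) w else 0) with hWdef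
  have hWm : ∀ M, Measurable (W M) := fun M =>
    Finset.measurable_sum _ fun i _ => Finset.measurable_sum _ fun j _ => by
      by_cases hij : i ≠ j
      · simp only [if_pos hij]; exact (hFtm M i j).indicator (hEm M i j)
      · simp only [if_neg hij]; exact measurable_const
  set SM : ℕ → Config n d X → ℝ≥0∞ := fun M z =>
    ∑ k ∈ Finset.Icc 1 M, W M (Φ.flow ((k : ℝ) * (τ / M)) z) with hSMdef
  have hSMm : ∀ M, Measurable (SM M) := fun M =>
    Finset.measurable_sum _ fun k _ => (hWm M).comp (Φ.measurable_flow _)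
  set Kstar : Config n d X → ℝ≥0∞ := fun z => liminf (fun M => SM M z) atTop with hKdef
  have hKm : Measurable Kstar := Measurable.liminf hSMm
  -- (i) the pathwise bound on the good set
  have hpath : ∀ z ∈ Φ.good, (∑ᶠ u ∈ collisionTimes G ε (fun t => Φ.flow t z) ∩ Icc 0 τ,
      ∑ i, ∑ j, (if i ≠ j ∧ ‖G.sepVec (Φ.flow u z i).1 (Φ.flow u z j).1‖ = ε
        then F (Φ.flow u z) i j else 0)) ≤ Kstar z := by
    intro z hz
    have hγ := Φ.isTrajectory z hz
    have hfin := hγ.locFinite 0 τ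
    rw [finsum_mem_eq_finite_toFinset_sum _ hfin]
    obtain ⟨g, hg, hgap⟩ := exists_gap_of_finite hfin
    show _ ≤ liminf (fun M => SM M z) atTop
    refine le_liminf_of_le (h := ?_)
    filter_upwards [eventually_gt_atTop ⌈τ / g⌉₊] with M hM
    have hM0 : 0 < M := lt_of_le_of_lt (Nat.zero_le _) hM
    have hMg : τ / M < g := by
      have h1 : τ / g < M := (Nat.le_ceil _).trans_lt (by exact_mod_cast hM)
      rw [div_lt_iff₀ hg] at h1
      rw [div_lt_iff₀ (by exact_mod_cast hM0)]
      linarith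
    exact sum_collision_le_sum_window hγ hτ hM0
      (fun u hu u' hu' hlt => hMg.trans_le (hgap u hu u' hu' hlt)) (E M) (hE M) F (Ft M) (hFt M)
  -- (ii) the mean of each grid sum (stationarity) and (iii) Fatou
  have hmeanM : ∀ M, ∫⁻ z, SM M z ∂P = (M : ℝ≥0∞) * ∫⁻ w, W M w ∂P := by
    intro M
    calc ∫⁻ z, SM M z ∂P = ∑ k ∈ Finset.Icc 1 M, ∫⁻ z, W M (Φ.flow ((k : ℝ) * (τ / M)) z) ∂P :=
          lintegral_finsetSum _ fun k _ => (hWm M).comp (Φ.measurable_flow _)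
      _ = ∑ _k ∈ Finset.Icc 1 M, ∫⁻ z, W M z ∂P :=
          Finset.sum_congr rfl fun k _ => (hstat _).lintegral_comp (hWm M)
      _ = (M : ℝ≥0∞) * ∫⁻ w, W M w ∂P := by
          rw [Finset.sum_const, Nat.card_Icc, Nat.add_sub_cancel, nsmul_eq_mul]
  have hmean : ∫⁻ z, Kstar z ∂P ≤ liminf (fun M : ℕ => (M : ℝ≥0∞) * ∫⁻ w, W M w ∂P) atTop := by
    refine (lintegral_liminf_le hSMm).trans (le_of_eq ?_)
    exact congrArg (fun u : ℕ → ℝ≥0∞ => liminf u atTop) (funext hmeanM)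
  -- (iv) the shift: `f ≤ Kstar ∘ Φ_s`, and stationarity once more
  have hle : ∀ z, f z ≤ Kstar (Φ.flow s z) := fun z => by
    by_cases hz : z ∈ Φ.good
    · exact (hf z hz).trans (hpath _ (Φ.mapsTo_good s hz))
    · rw [hf0 z hz]; exact bot_le
  calc ∫⁻ z, f z ∂P ≤ ∫⁻ z, Kstar (Φ.flow s z) ∂P := lintegral_mono hle
    _ = ∫⁻ z, Kstar z ∂P := (hstat s).lintegral_comp hKm
    _ ≤ _ := hmean

/-- **Pathwise counting.** On a good orbit, the number of collision times of sphere `i` in `[s, t)` is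
at most the collision sum, over `[0, t − s]` along the orbit of the shifted datum `Φ_s z`, of the index
mark `F(p, q) = 1{p = i ∨ q = i}`: the group property `Φ_u z = Φ_{u−s}(Φ_s z)` maps the former set of
times injectively into the collision times of `i` along the latter orbit, and at each of these some
ordered contact pair contains `i` (`Participates`, `mem_contactPairs`). [folklore] -/
theorem natCast_ncard_collisionTimesOf_le {d X : Type*} [Fintype d] [MeasureSpace X]
    [TopologicalSpace X] {G : Geometry d X} {ε : ℝ} {n : ℕ} (Φ : HardSphereFlow G ε n) (i : Fin n)
    (s t : ℝ) {z : Config n d X} (hz : z ∈ Φ.good) :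
    (((collisionTimesOf G ε (fun u => Φ.flow u z) i ∩ Ico s t).ncard : ℕ) : ℝ≥0∞) ≤
      ∑ᶠ u ∈ collisionTimes G ε (fun t => Φ.flow t (Φ.flow s z)) ∩ Icc 0 (t - s),
        ∑ p : Fin n, ∑ q : Fin n,
          (if p ≠ q ∧ ‖G.sepVec (Φ.flow u (Φ.flow s z) p).1 (Φ.flow u (Φ.flow s z) q).1‖ = ε
            then (if p = i ∨ q = i then (1 : ℝ≥0∞) else 0) else 0) := by
  classical
  have hfin := (Φ.isTrajectory _ (Φ.mapsTo_good s hz)).locFinite 0 (t - s)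
  rw [finsum_mem_eq_finite_toFinset_sum _ hfin]
  -- the two sets of times; the shift `u ↦ u - s` maps `A` into `B` injectively
  set A : Set ℝ := collisionTimesOf G ε (fun u => Φ.flow u z) i ∩ Ico s t with hA
  set B : Set ℝ := collisionTimesOf G ε (fun u => Φ.flow u (Φ.flow s z)) i ∩ Icc 0 (t - s) with hB
  have hBsub : B ⊆ collisionTimes G ε (fun t => Φ.flow t (Φ.flow s z)) ∩ Icc 0 (t - s) :=
    inter_subset_inter_left _ (collisionTimesOf_subset _ i)
  have hBfin : B.Finite := hfin.subset hBsub
  have hmaps : ∀ u ∈ A, u - s ∈ B := by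
    rintro u ⟨hu, hus, hut⟩
    refine ⟨?_, by linarith, by linarith⟩
    show Participates G ε (Φ.flow (u - s) (Φ.flow s z)) i
    rw [← Φ.flow_add (u - s) s z hz, sub_add_cancel]
    exact hu
  have hAB : A.ncard ≤ B.ncard :=
    ncard_le_ncard_of_injOn (fun u => u - s) hmaps (sub_left_injective.injOn) hBfin
  -- at a collision time of `i` the index mark contributes at least `1`
  have hone : ∀ u ∈ B, (1 : ℝ≥0∞) ≤ ∑ p : Fin n, ∑ q : Fin n,
      (if p ≠ q ∧ ‖G.sepVec (Φ.flow u (Φ.flow s z) p).1 (Φ.flow u (Φ.flow s z) q).1‖ = ε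
        then (if p = i ∨ q = i then (1 : ℝ≥0∞) else 0) else 0) := by
    intro u hu
    obtain ⟨p₀, q₀, hc₀, hi₀⟩ : ∃ p₀ q₀ : Fin n,
        (p₀ ≠ q₀ ∧ ‖G.sepVec (Φ.flow u (Φ.flow s z) p₀).1 (Φ.flow u (Φ.flow s z) q₀).1‖ = ε) ∧
          (p₀ = i ∨ q₀ = i) := by
      obtain ⟨⟨j, hj | hj⟩, -⟩ := hu
      · obtain ⟨hij, hc⟩ := mem_contactPairs.1 hj
        exact ⟨i, j, ⟨hij, (mem_contactSet.1 hc).2⟩, Or.inl rfl⟩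
      · obtain ⟨hji, hc⟩ := mem_contactPairs.1 hj
        exact ⟨j, i, ⟨hji, (mem_contactSet.1 hc).2⟩, Or.inr rfl⟩
    calc (1 : ℝ≥0∞) = (if p₀ ≠ q₀ ∧ ‖G.sepVec (Φ.flow u (Φ.flow s z) p₀).1
          (Φ.flow u (Φ.flow s z) q₀).1‖ = ε then (if p₀ = i ∨ q₀ = i then (1 : ℝ≥0∞) else 0) else 0) := by
          rw [if_pos hc₀, if_pos hi₀]
      _ ≤ ∑ q : Fin n, (if p₀ ≠ q ∧ ‖G.sepVec (Φ.flow u (Φ.flow s z) p₀).1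
          (Φ.flow u (Φ.flow s z) q).1‖ = ε then (if p₀ = i ∨ q = i then (1 : ℝ≥0∞) else 0) else 0) :=
          Finset.single_le_sum (f := fun q => (if p₀ ≠ q ∧ ‖G.sepVec (Φ.flow u (Φ.flow s z) p₀).1
            (Φ.flow u (Φ.flow s z) q).1‖ = ε then (if p₀ = i ∨ q = i then (1 : ℝ≥0∞) else 0) else 0))
            (fun _ _ => bot_le) (Finset.mem_univ q₀)
      _ ≤ _ := Finset.single_le_sum (f := fun p => ∑ q : Fin n,
            (if p ≠ q ∧ ‖G.sepVec (Φ.flow u (Φ.flow s z) p).1 (Φ.flow u (Φ.flow s z) q).1‖ = ε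
              then (if p = i ∨ q = i then (1 : ℝ≥0∞) else 0) else 0))
            (fun _ _ => bot_le) (Finset.mem_univ p₀)
  calc ((A.ncard : ℕ) : ℝ≥0∞) ≤ ((B.ncard : ℕ) : ℝ≥0∞) := by exact_mod_cast hAB
    _ = ∑ _u ∈ hBfin.toFinset, (1 : ℝ≥0∞) := by
        rw [ncard_eq_toFinset_card B hBfin, Finset.sum_const, nsmul_eq_mul, mul_one]
    _ ≤ ∑ u ∈ hBfin.toFinset, ∑ p : Fin n, ∑ q : Fin n,
          (if p ≠ q ∧ ‖G.sepVec (Φ.flow u (Φ.flow s z) p).1 (Φ.flow u (Φ.flow s z) q).1‖ = ε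
            then (if p = i ∨ q = i then (1 : ℝ≥0∞) else 0) else 0) :=
        Finset.sum_le_sum fun u hu => hone u (hBfin.mem_toFinset.1 hu)
    _ ≤ _ := Finset.sum_le_sum_of_subset fun u hu =>
        hfin.mem_toFinset.2 (hBsub (hBfin.mem_toFinset.1 hu))

/-- **The mean number of collisions of one sphere in a window, under the canonical law.** For
`SmallDensity uniformProfile σ`, `N ≥ 1`, a flow `Φ`, a sphere `i` and `s < t`:
`∫⁻ 𝟙_good · #{collision times of i in [s,t)} dG ≤ 32 (N+1) ε² (t − s) · ∫ ‖w − v‖ dN(0,1)^{⊗2}`,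
`G = localGibbsLaw σ 1 0 1 N Φ` (a lower integral: no measurability is needed) — the abstract window
bound `lintegral_le_liminf_of_le_collisionSum` with the index mark of `natCast_ncard_collisionTimesOf_le`,
the one-window statics `exists_windowEvent` (`exists_sweptTube`,
`volume_setOf_exists_reprSym_add_latticeVec_mem_le`, `posGibbs_pairEvent_le`), stationarity
`measurePreserving_flow_localGibbsLaw_const`; `Σ_{p,q} (1{p=i} + 1{q=i}) = 2(N+1)`, `M · (τ/M) = τ`. [folklore] -/
theorem lintegral_windowCount_le {σ : ℝ} (hsm : SmallDensity uniformProfile σ) {N : ℕ} (hN : 1 ≤ N)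
    (Φ : HardSphereFlow (Torus.geometry (Fin 3)) (hsDiameter σ N) (N + 1)) (i : Fin (N + 1))
    {s t : ℝ} (hst : s < t) :
    ∫⁻ z, ENNReal.ofReal (if z ∈ Φ.good then
        ((collisionTimesOf (Torus.geometry (Fin 3)) (hsDiameter σ N) (fun u => Φ.flow u z) i ∩
            Set.Ico s t).ncard : ℝ)
        else 0) ∂(localGibbsLaw σ (fun _ => 1) (fun _ => 0) (fun _ => 1) N Φ) ≤
      ENNReal.ofReal (32 * ((N + 1 : ℕ) : ℝ) * hsDiameter σ N ^ 2 * (t - s)) *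
        ∫⁻ p, ENNReal.ofReal ‖p.2 - p.1‖ ∂((gaussMeasure (0 : V3) 1).prod (gaussMeasure (0 : V3) 1)) := by
  classical
  have hε : 0 < hsDiameter σ N := hsDiameter_pos hsm.σ_pos N
  set τ : ℝ := t - s with hτdef
  have hτ : 0 < τ := sub_pos.2 hst
  set P := localGibbsLaw σ (fun _ => (1 : ℝ)) (fun _ => (0 : V3)) (fun _ => (1 : ℝ)) N Φ with hP
  set I₁ : ℝ≥0∞ := ∫⁻ p, ENNReal.ofReal ‖p.2 - p.1‖
    ∂((gaussMeasure (0 : V3) 1).prod (gaussMeasure (0 : V3) 1)) with hI₁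
  have hnm : Measurable fun p : V3 × V3 => ENNReal.ofReal ‖p.2 - p.1‖ :=
    (measurable_snd.sub measurable_fst).norm.ennreal_ofReal
  -- the index mark and the lift inequality
  set c : Fin (N + 1) → Fin (N + 1) → ℝ≥0∞ := fun p q => if p = i ∨ q = i then 1 else 0 with hc
  have hlift : ∀ B : Set V3, MeasurableSet B →
      volume {x : T3 | ∃ k : Fin 3 → ℤ, Torus.reprSym x + Torus.latticeVec k ∈ B} ≤ volume B :=
    fun B hB => by simpa only [sub_zero] using volume_setOf_exists_reprSym_add_latticeVec_mem_le 0 hB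
  -- the window events, for every mesh `τ / M` and every ordered pair
  have hev : ∀ (M : ℕ) (p q : Fin (N + 1)), ∃ E : Set (Config (N + 1) (Fin 3) T3), MeasurableSet E ∧
      (p ≠ q → ∀ w ∈ hardSphereDomain (Torus.geometry (Fin 3)) (N + 1) (hsDiameter σ N),
        ∀ t ∈ Icc 0 (τ / M),
        ‖(Torus.geometry (Fin 3)).sepVec ((freeFlight (Torus.geometry (Fin 3)) (-t) w p).1)
          ((freeFlight (Torus.geometry (Fin 3)) (-t) w q).1)‖ = hsDiameter σ N → w ∈ E) ∧
      (p ≠ q → ∫⁻ w, E.indicator (fun _ => c p q) w ∂P ≤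
        ENNReal.ofReal (16 * hsDiameter σ N ^ 2 * (τ / M)) * (I₁ * c p q)) := by
    intro M p q
    by_cases hpq : p ≠ q
    · have hh : 0 ≤ τ / M := div_nonneg hτ.le (Nat.cast_nonneg M)
      obtain ⟨S, hSm, hSvol, hS⟩ := exists_sweptTube hε hh
      obtain ⟨E, hEm, hEc, hEb⟩ := exists_windowEvent hsm.σ_lt_half.le one_pos one_pos (0 : V3) hh hpq
        (fun T hT => posGibbs_pairEvent_le hsm hN hpq hT) hSm hSvol hS hlift
      refine ⟨E, hEm, fun _ => hEc, fun _ => ?_⟩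
      have h := hEb Φ (fun _ => c p q) measurable_const
      rwa [lintegral_mul_const _ hnm] at h
    · exact ⟨∅, MeasurableSet.empty, fun h => absurd h hpq, fun h => absurd h hpq⟩
  choose E hEm hEc hEb using hev
  -- the abstract window bound for the lower integral
  have hgen := lintegral_le_liminf_of_le_collisionSum Φ P
    (measurePreserving_flow_localGibbsLaw_const σ 1 1 0 N Φ) hτ (fun _ p q => c p q)
    (fun M p q => E M p q) hEm (fun M p q hpq => hEc M p q hpq) (fun _ _ p q => c p q)
    (fun _ _ _ => measurable_const) (fun M p q _ w _ u _ _ => le_rfl) s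
    (fun z => ENNReal.ofReal (if z ∈ Φ.good then
        ((collisionTimesOf (Torus.geometry (Fin 3)) (hsDiameter σ N) (fun u => Φ.flow u z) i ∩
            Set.Ico s t).ncard : ℝ) else 0))
    (fun z hz => by
      rw [if_pos hz, ENNReal.ofReal_natCast]
      exact natCast_ncard_collisionTimesOf_le Φ i s t hz)
    (fun z hz => by rw [if_neg hz, ENNReal.ofReal_zero])
  -- the mean of one window
  have hB : ∀ M : ℕ, (M : ℝ≥0∞) * ∫⁻ w, ∑ p, ∑ q,
      (if p ≠ q then (E M p q).indicator (fun _ => c p q) w else 0) ∂P ≤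
        ENNReal.ofReal (32 * ((N + 1 : ℕ) : ℝ) * hsDiameter σ N ^ 2 * τ) * I₁ := by
    intro M
    rcases Nat.eq_zero_or_pos M with hM0 | hM0
    · subst hM0
      simp only [Nat.cast_zero, zero_mul, zero_le]
    have hM' : (0 : ℝ) < M := by exact_mod_cast hM0
    set Bw : ℝ≥0∞ := ENNReal.ofReal (16 * hsDiameter σ N ^ 2 * (τ / M)) * I₁ with hBw
    have hterm : ∀ p q : Fin (N + 1), ∫⁻ w, (if p ≠ q then (E M p q).indicator
        (fun _ => c p q) w else 0) ∂P ≤ (if p = i then Bw else 0) + (if q = i then Bw else 0) := by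
      intro p q
      by_cases hpq : p ≠ q
      · simp only [if_pos hpq]
        refine (hEb M p q hpq).trans ?_
        rw [← mul_assoc, ← hBw, hc]
        by_cases hp : p = i <;> by_cases hq : q = i <;> simp [hp, hq]
      · simp only [if_neg hpq, lintegral_zero, zero_le]
    have hmeas : ∀ p q : Fin (N + 1), Measurable fun w : Config (N + 1) (Fin 3) T3 =>
        (if p ≠ q then (E M p q).indicator (fun _ => c p q) w else 0) := fun p q => by
      by_cases hpq : p ≠ q
      · simp only [if_pos hpq]; exact measurable_const.indicator (hEm M p q)
      · simp only [if_neg hpq]; exact measurable_const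
    have h1 : ∑ p : Fin (N + 1), ∑ _q : Fin (N + 1), (if p = i then Bw else 0) =
        ((N + 1 : ℕ) : ℝ≥0∞) * Bw := by
      rw [Finset.sum_comm]
      simp only [Finset.sum_ite_eq', Finset.mem_univ, if_true, Finset.sum_const, Finset.card_univ,
        Fintype.card_fin, nsmul_eq_mul]
    have h2 : ∑ _p : Fin (N + 1), ∑ q : Fin (N + 1), (if q = i then Bw else 0) =
        ((N + 1 : ℕ) : ℝ≥0∞) * Bw := by
      simp only [Finset.sum_ite_eq', Finset.mem_univ, if_true, Finset.sum_const, Finset.card_univ,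
        Fintype.card_fin, nsmul_eq_mul]
    have hprod : (M : ℝ≥0∞) * (((N + 1 : ℕ) : ℝ≥0∞) * Bw + ((N + 1 : ℕ) : ℝ≥0∞) * Bw) =
        ENNReal.ofReal (32 * ((N + 1 : ℕ) : ℝ) * hsDiameter σ N ^ 2 * τ) * I₁ := by
      have e1 : (M : ℝ≥0∞) = ENNReal.ofReal (M : ℝ) := (ENNReal.ofReal_natCast M).symm
      have e2 : ((N + 1 : ℕ) : ℝ≥0∞) = ENNReal.ofReal ((N + 1 : ℕ) : ℝ) :=
        (ENNReal.ofReal_natCast _).symm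
      rw [← two_mul, hBw, e1, e2, ← mul_assoc, ← mul_assoc, ← mul_assoc, ← ENNReal.ofReal_ofNat 2,
        ← ENNReal.ofReal_mul (Nat.cast_nonneg _), ← ENNReal.ofReal_mul (by positivity),
        ← ENNReal.ofReal_mul (by positivity)]
      congr 1
      congr 1
      field_simp
      ring
    calc (M : ℝ≥0∞) * ∫⁻ w, ∑ p, ∑ q, (if p ≠ q then (E M p q).indicator (fun _ => c p q) w else 0) ∂P
        = (M : ℝ≥0∞) * ∑ p, ∑ q, ∫⁻ w,
            (if p ≠ q then (E M p q).indicator (fun _ => c p q) w else 0) ∂P := by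
          congr 1
          rw [lintegral_finsetSum _ fun p _ => Finset.measurable_sum _ fun q _ => hmeas p q]
          exact Finset.sum_congr rfl fun p _ => lintegral_finsetSum _ fun q _ => hmeas p q
      _ ≤ (M : ℝ≥0∞) * ∑ p : Fin (N + 1), ∑ q : Fin (N + 1),
            ((if p = i then Bw else 0) + (if q = i then Bw else 0)) := by
          gcongr with p _ q _
          exact hterm p q
      _ = (M : ℝ≥0∞) * ((∑ p : Fin (N + 1), ∑ _q : Fin (N + 1), (if p = i then Bw else 0)) +
            ∑ _p : Fin (N + 1), ∑ q : Fin (N + 1), (if q = i then Bw else 0)) := by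
          congr 1
          rw [← Finset.sum_add_distrib]
          exact Finset.sum_congr rfl fun p _ => Finset.sum_add_distrib
      _ = (M : ℝ≥0∞) * (((N + 1 : ℕ) : ℝ≥0∞) * Bw + ((N + 1 : ℕ) : ℝ≥0∞) * Bw) := by rw [h1, h2]
      _ = ENNReal.ofReal (32 * ((N + 1 : ℕ) : ℝ) * hsDiameter σ N ^ 2 * τ) * I₁ := hprod
  exact hgen.trans (liminf_le_of_frequently_le' (Frequently.of_forall hB))

/-- **Registered helper stub `stub_windowCountIntegrableInvariant`** (H2) of the line `Sketch` (card
`hazard-fairness-compensator`) of crux stmt-AtomisticToContinuum-13481: there are a universal `Cf > 0`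
and a `σ₀ > 0` such that for `0 < σ < σ₀`, every `N ≥ 1`, flow `Φ`, sphere `i` and `s ≤ t`, IF the
windowed collision count `D(z) = #{collision times of i in [s, t) along the orbit of z}` (on the good
set; `0` off it) is measurable, then it is integrable under the invariant canonical law
`G = localGibbsLaw σ 1 0 1 N Φ` with `E_G[D] ≤ Cf σ² (N+1)^{1/3} (t − s)` — the Boltzmann–Enskog
collision flux onto one sphere, uniformly in `N` (`lintegral_windowCount_le`, `FluidPDE.succ_mul_hsDiameter_sq`;
`σ₀` from `exists_smallDensity uniformProfile`, `Cf = 32 ∫‖w − v‖ dN(0,1)^{⊗2} + 1`). [folklore] -/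
theorem stub_windowCountIntegrableInvariant :
    ∃ Cf : ℝ, 0 < Cf ∧ ∃ σ₀ : ℝ, 0 < σ₀ ∧ ∀ (σ : ℝ), 0 < σ → σ < σ₀ →
      ∀ (N : ℕ) (Φ : HardSphereFlow (Torus.geometry (Fin 3)) (hsDiameter σ N) (N + 1))
      (i : Fin (N + 1)) (s t : ℝ), 1 ≤ N → s ≤ t →
      Measurable (fun z : Config (N + 1) (Fin 3) T3 =>
        if z ∈ Φ.good then
          ((collisionTimesOf (Torus.geometry (Fin 3)) (hsDiameter σ N) (fun u => Φ.flow u z) i ∩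
              Set.Ico s t).ncard : ℝ)
        else 0) →
      Integrable (fun z : Config (N + 1) (Fin 3) T3 =>
        if z ∈ Φ.good then
          ((collisionTimesOf (Torus.geometry (Fin 3)) (hsDiameter σ N) (fun u => Φ.flow u z) i ∩
              Set.Ico s t).ncard : ℝ)
        else 0) (localGibbsLaw σ (fun _ => 1) (fun _ => 0) (fun _ => 1) N Φ) ∧
      ∫ z, (if z ∈ Φ.good then
          ((collisionTimesOf (Torus.geometry (Fin 3)) (hsDiameter σ N) (fun u => Φ.flow u z) i ∩
              Set.Ico s t).ncard : ℝ)
        else 0) ∂(localGibbsLaw σ (fun _ => 1) (fun _ => 0) (fun _ => 1) N Φ) ≤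
        Cf * σ ^ 2 * ((N + 1 : ℕ) : ℝ) ^ (1 / 3 : ℝ) * (t - s) := by
  classical
  -- the universal constant: the Gaussian flux moment
  set I₁ : ℝ≥0∞ := ∫⁻ p, ENNReal.ofReal ‖p.2 - p.1‖
    ∂((gaussMeasure (0 : V3) 1).prod (gaussMeasure (0 : V3) 1)) with hI₁
  have hI₁ne : I₁ ≠ ∞ := lintegral_norm_sub_gauss_ne_top 0 1
  have hI₁0 : 0 ≤ I₁.toReal := ENNReal.toReal_nonneg
  refine ⟨32 * I₁.toReal + 1, by positivity, ?_⟩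
  obtain ⟨σ₀, hσ₀, hsmall⟩ := exists_smallDensity uniformProfile one_pos
  refine ⟨σ₀, hσ₀, fun σ hσ hσlt N Φ i s t hN hst hDm => ?_⟩
  have hsm : SmallDensity uniformProfile σ := (hsmall σ hσ hσlt).1
  set P := localGibbsLaw σ (fun _ => (1 : ℝ)) (fun _ => (0 : V3)) (fun _ => (1 : ℝ)) N Φ with hP
  set D : Config (N + 1) (Fin 3) T3 → ℝ := fun z => if z ∈ Φ.good then
      ((collisionTimesOf (Torus.geometry (Fin 3)) (hsDiameter σ N) (fun u => Φ.flow u z) i ∩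
          Set.Ico s t).ncard : ℝ) else 0 with hD
  have hD0 : ∀ z, 0 ≤ D z := fun z => by simp only [hD]; positivity
  -- the bound on the lower integral (the empty window `t = s` apart)
  have hts : 0 ≤ t - s := sub_nonneg.2 hst
  set R : ℝ := 32 * ((N + 1 : ℕ) : ℝ) * hsDiameter σ N ^ 2 * (t - s) with hR
  have hR0 : 0 ≤ R := by rw [hR]; positivity
  have hlint : ∫⁻ z, ENNReal.ofReal (D z) ∂P ≤ ENNReal.ofReal (R * I₁.toReal) := by
    rcases eq_or_lt_of_le hst with heq | hlt
    · subst heq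
      have hzero : ∀ z, D z = 0 := fun z => by
        simp only [hD, Set.Ico_self, Set.inter_empty, Set.ncard_empty, Nat.cast_zero, ite_self]
      simp only [hzero, ENNReal.ofReal_zero, lintegral_zero, zero_le]
    · calc ∫⁻ z, ENNReal.ofReal (D z) ∂P
          ≤ ENNReal.ofReal R * I₁ := lintegral_windowCount_le hsm hN Φ i hlt
        _ = ENNReal.ofReal (R * I₁.toReal) := by
            rw [ENNReal.ofReal_mul hR0, ENNReal.ofReal_toReal hI₁ne]
  -- integrability and the mean
  have hint : Integrable D P := ⟨hDm.aestronglyMeasurable,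
    (hasFiniteIntegral_iff_ofReal (ae_of_all _ hD0)).2 (hlint.trans_lt ENNReal.ofReal_lt_top)⟩
  refine ⟨hint, ?_⟩
  have hmean : ∫ z, D z ∂P ≤ R * I₁.toReal := by
    rw [integral_eq_lintegral_of_nonneg_ae (ae_of_all _ hD0) hDm.aestronglyMeasurable]
    exact ENNReal.toReal_le_of_le_ofReal (mul_nonneg hR0 hI₁0) hlint
  refine hmean.trans ?_
  have hkey : R * I₁.toReal = 32 * I₁.toReal * (σ ^ 2 * ((N + 1 : ℕ) : ℝ) ^ (1 / 3 : ℝ)) * (t - s) := by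
    rw [hR, ← succ_mul_hsDiameter_sq σ N]
    ring
  rw [hkey]
  nlinarith [show 0 ≤ σ ^ 2 * ((N + 1 : ℕ) : ℝ) ^ (1 / 3 : ℝ) * (t - s) by positivity]

end Summit.AtomisticToContinuum.HydrodynamicLimit.Theorems.CollisionRate

end
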